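import Summits.BirchSwinnertonDyer.BirchSwinnertonDyer.Theses.ByReductionTypeAtTwo
import Summits.BirchSwinnertonDyer.Rank1Residual.X5.TwoAdicTargetsMultKatoRat
import Summits.BirchSwinnertonDyer.Rank1Residual.X5.TwoAdicTargetsSplitGS
import HarnessLib

/-!
# Route `ByReductionTypeAtTwo`, crux `MultiplicativeRankZeroAtTwo` (item stmt-BirchSwinnertonDyer-19096):
# Theorems-side BRIDGES from the cell's typed layer-2 objects (nothing asserted)

Two kernel certificates that the route's foreseen glued split
`MultiplicativeRankZeroAtTwo ⇐ (upper half) → (lower half)` (route file, TWO-LAYER PLAN) composes,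
stated against the REGISTERED crux constant
`Summit.BirchSwinnertonDyer.BirchSwinnertonDyer.Theses.ByReductionTypeAtTwo.MultiplicativeRankZeroAtTwo`:

* `multiplicativeRankZeroAtTwo_of_halves` — Miller's currency: Gross–Zagier–Kolyvagin (the tree's
  named fact `rank_eq_analyticRank_of_analyticRank_le_one`, a hypothesis) + the UPPER half
  `ord₂ #Ш ≤ ord₂ #Ш_an` (`Typed.MissingUpperBoundAt W 2`, Euler-system direction) + the LOWER half
  `ord₂ #Ш_an ≤ ord₂ #Ш` (`Typed.MissingLowerBoundAt W 2`, main-conjecture direction), each ∀-closed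
  over the crux's class (non-CM, analytic rank `0`, multiplicative at `2`), give the crux
  (`missingPPartAt_of_lower_of_upper` + `bsdp_of_missingPPartAt`). This is the planner's BC3 birth
  composition `MultiplicativeRankZeroAtTwo_of` (evidence `MultiplicativeRankZeroAtTwo_birth.lean` on
  the item) with the stand-in replaced by the route decl.
* `multiplicativeRankZeroAtTwo_of_muRoad` — the cell's `μ = 0` ROAD, ∀-closed: the four
  multiplicative-at-`2` END doors of `X5/TwoAdicTargetsMultKatoRat.lean` (p400711,
  `O1.bsdp_two_{nonsplit,split}_of_mu_eq_zero_of_lowerBound_of_multRat`) consume, per pair,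
  PRINT {Greenberg's Thm-4.1 analogues at a non-split / split multiplicative prime
  (`thm41Analogue_charValue_rankZero_numberField_anyPrime`,
  `thm41Analogue_charValue_rankZero_split_baseChange_anyPrime`), modularity
  (`nonempty_modularParametrizationData`), GZK} + the seat's memo-proved binder
  `O1.KatoMultiplicativeDivisibilityRat W 2` (Kato `⊗ℚ` at a multiplicative `2`, HOME
  mult/PROOF-MULT.md, referee RC-2 PASS; typed `@[conjecture]`, here a HYPOTHESIS) + at a split `2`
  the Greenberg–Stevens formula `greenberg_stevens W 2` (HOME mult/PROOF-GS2.md, RC-4 PASS; feeds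
  `hκ₁` through `O1.kappaOne_of_greenbergStevens`, p401547) + the OPEN class-wide objects
  {`μ(X(E/ℚ_∞)) = 0`, the period integrality `hper₀`, the lower half `hlow`}. Quantifying every
  binder over the class turns the per-pair doors into `… → MultiplicativeRankZeroAtTwo`.

HONEST FRAMING (cell bsd-2adic, seat bsd-2adic-mult GEN 4): these are COMPOSITION certificates for
`ledger route edit --split`; every research input stays a hypothesis; no class is closed here.
PARTITION: X5@2 mult (K4ᵐ, RESIDUAL-MAP B1·O1; 1 976 book230 classes) × p = 2 —
types-the-object-of; closes none.
[cite: Miller2011LMS, Def 1.1] [cite: Kato2004Asterisque, Thm 17.4 and 17.13]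
[cite: GreenbergLNM1716, §4 pp. 112–113] [cite: Kobayashi2006DocMath, Cor 4.2]
-/

set_option autoImplicit false
set_option linter.dupNamespace false

noncomputable section

open scoped Classical MatrixGroups ModularForm

open CongruenceSubgroup WeierstrassCurve Literature.NumberTheory.EllipticCurves
  Literature.NumberTheory.EllipticCurves.ModularForms
  Literature.NumberTheory.EllipticCurves.Greenberg1999
  Literature.NumberTheory.EllipticCurves.Rank1Residual
  Literature.NumberTheory.EllipticCurves.Rank1Residual.Typed
  Summit.BirchSwinnertonDyer.Rank1Residual.X5

namespace Summit.BirchSwinnertonDyer.BirchSwinnertonDyer.Theorems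

/-- **Bridge (two halves ⇒ crux).** Gross–Zagier–Kolyvagin + the upper half `ord₂ #Ш ≤ ord₂ #Ш_an`
+ the lower half `ord₂ #Ш_an ≤ ord₂ #Ш`, both ∀-closed over non-CM `E/ℚ` of analytic rank `0`
multiplicative at `2`, imply the crux `MultiplicativeRankZeroAtTwo` (Miller's last clause by
`missingPPartAt_of_lower_of_upper`, then `BSD(E,2)` by `bsdp_of_missingPPartAt`). Composition
certificate; nothing asserted. [cite: Miller2011LMS, Def 1.1] -/
theorem multiplicativeRankZeroAtTwo_of_halves
    (hGZK : rank_eq_analyticRank_of_analyticRank_le_one)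
    (hU : ∀ (W : WeierstrassCurve ℚ) [W.IsElliptic] [W.IsGloballyMinimal],
      ¬ W.HasCM → W.analyticRank = 0 → Mult W 2 → MissingUpperBoundAt W 2)
    (hL : ∀ (W : WeierstrassCurve ℚ) [W.IsElliptic] [W.IsGloballyMinimal],
      ¬ W.HasCM → W.analyticRank = 0 → Mult W 2 → MissingLowerBoundAt W 2) :
    Summit.BirchSwinnertonDyer.BirchSwinnertonDyer.Theses.ByReductionTypeAtTwo.MultiplicativeRankZeroAtTwo := by
  unfold Summit.BirchSwinnertonDyer.BirchSwinnertonDyer.Theses.ByReductionTypeAtTwo.MultiplicativeRankZeroAtTwo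
  intro W _ _ hcm hr hmult
  exact bsdp_of_missingPPartAt W 2 hGZK (by omega)
    (missingPPartAt_of_lower_of_upper W 2 (hL W hcm hr hmult) (hU W hcm hr hmult))

/-- **Bridge (the `μ = 0` road ⇒ crux).** The multiplicative-at-`2` END doors of p400711, ∀-closed:
PRINT {Thm-4.1 analogues non-split / split (`h41ns`, `h41sp`), modularity `hmod`, GZK `hGZK`} + the
memo-proved binders {Kato `⊗ℚ` at a multiplicative `2` (`hKato`, typed `@[conjecture]`
`O1.KatoMultiplicativeDivisibilityRat`, a hypothesis), Greenberg–Stevens at `2` (`hGS`, split case,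
converted to `hκ₁` by `O1.kappaOne_of_greenbergStevens`)} + the OPEN class-wide objects
{`hμ` : `μ(X(E/ℚ_∞)) = 0` for every cyclotomic dual datum, `hper₀` : the newform's plus period is
`2`-integral against the Néron period, `hlow` : the lower half} over non-CM `E` of analytic rank `0`
multiplicative at `2` imply `MultiplicativeRankZeroAtTwo` (cases non-split / split:
`O1.bsdp_two_nonsplit_of_mu_eq_zero_of_lowerBound_of_multRat`,
`O1.bsdp_two_split_of_mu_eq_zero_of_lowerBound_of_multRat`). Composition certificate; nothing
asserted. [cite: Kato2004Asterisque, Thm 17.4 and 17.13] [cite: GreenbergLNM1716, §4 pp. 112–113]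
[cite: Kobayashi2006DocMath, Cor 4.2] [cite: Miller2011LMS, Def 1.1] -/
theorem multiplicativeRankZeroAtTwo_of_muRoad
    (hKato : ∀ (W : WeierstrassCurve ℚ) [W.IsElliptic] [W.IsGloballyMinimal],
      ¬ W.HasCM → Mult W 2 → O1.KatoMultiplicativeDivisibilityRat W 2)
    (h41ns : thm41Analogue_charValue_rankZero_numberField_anyPrime)
    (h41sp : thm41Analogue_charValue_rankZero_split_baseChange_anyPrime)
    (hmod : nonempty_modularParametrizationData)
    (hGZK : rank_eq_analyticRank_of_analyticRank_le_one)
    (hGS : ∀ (W : WeierstrassCurve ℚ) [W.IsElliptic] [W.IsGloballyMinimal],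
      W.HasSplitMultiplicativeReductionAtPrime 2 → greenberg_stevens (W := W) (p := 2))
    (hμ : ∀ (W : WeierstrassCurve ℚ) [W.IsElliptic] [W.IsGloballyMinimal],
      ¬ W.HasCM → W.analyticRank = 0 → Mult W 2 →
      ∀ (κ : ZpExtension ℚ 2) (γ : Field.absoluteGaloisGroup ℚ), κ.IsCyclotomic →
        κ.IsTopGenerator γ → IsCyclotomicVariable 2 γ → ∀ D : W.SelmerDualData κ γ, D.mu = 0)
    (hper₀ : ∀ (W : WeierstrassCurve ℚ) [W.IsElliptic] [W.IsGloballyMinimal],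
      ¬ W.HasCM → W.analyticRank = 0 → Mult W 2 →
      ∀ [NeZero (W.conductorNorm ℤ)] (f : CuspForm (Gamma0 (W.conductorNorm ℤ)) 2),
        IsNewformOf W f → ∀ ϖ : ℚ, (ϖ : ℝ) * W.realPeriodRat = plusPeriod f → 0 ≤ padicValRat 2 ϖ)
    (hlow : ∀ (W : WeierstrassCurve ℚ) [W.IsElliptic] [W.IsGloballyMinimal],
      ¬ W.HasCM → W.analyticRank = 0 → Mult W 2 → MissingLowerBoundAt W 2) :
    Summit.BirchSwinnertonDyer.BirchSwinnertonDyer.Theses.ByReductionTypeAtTwo.MultiplicativeRankZeroAtTwo := by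
  unfold Summit.BirchSwinnertonDyer.BirchSwinnertonDyer.Theses.ByReductionTypeAtTwo.MultiplicativeRankZeroAtTwo
  intro W _ _ hcm hr hmult
  by_cases hsp : W.HasSplitMultiplicativeReductionAtPrime 2
  · exact O1.bsdp_two_split_of_mu_eq_zero_of_lowerBound_of_multRat W (hKato W hcm hmult) h41sp hmod
      hGZK (hμ W hcm hr hmult)
      (fun f hf L hL Dq => O1.kappaOne_of_greenbergStevens W (hGS W hsp) hr hf hL Dq)
      (hper₀ W hcm hr hmult) hr hmult hsp (hlow W hcm hr hmult)
  · exact O1.bsdp_two_nonsplit_of_mu_eq_zero_of_lowerBound_of_multRat W (hKato W hcm hmult) h41ns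
      hmod hGZK (hμ W hcm hr hmult) (hper₀ W hcm hr hmult) hr hmult hsp (hlow W hcm hr hmult)

end Summit.BirchSwinnertonDyer.BirchSwinnertonDyer.Theorems

end
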